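import Summits.Ventures.YMGap.RobustBall.OneStateBoundary
import Summits.Ventures.YMGap.RobustBall.MassGapOnBallZdGRowsSUN
import Summits.Ventures.YMGap.RobustBall.RowsS
import Summits.Ventures.YMGap.RobustBall.RowsSUN
import Summits.Ventures.YMGap.Thresholds.ImprovedThresholdStar
import Summits.Ventures.YMGap.Thresholds.SharpStrongCouplingFree
import HarnessLib

/-!
# Venture YMGap, track ROBUST-BALL — ONE STATE, step 8 (rows): every boundary condition converges to the one state —
# the cells of record, hypothesis-free by name

HONEST FRAMING. WHAT THIS IS: a venture file (cell `pub-ymgap`, track Y2 ROBUST-BALL, seat ds-3): the currency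
theorems of `OneStateBoundary.lean` (one DLR state = the limit of the finite-volume Gibbs distributions with ARBITRARY
boundary fields, sequence form and uniform form) instantiated on landed rows. CELLS: `SU(2)` `ℤ⁴` Wilson at every tree
coupling `|b| ≤ 9/50` (Wilson `|β_W| ≤ 9/25`, two-sided; `su2_wilson_boundaryLimit_of_abs_le`, from ds-3/ds-1's
`su2_hasUniqueGibbsMeasure_of_abs_le`); every `N ≥ 2`, every `d ≥ 2`, Wilson at 't Hooft `|β| < 1/(8d)`
(`suN_wilson_boundaryLimit_sharp`, from p1's `massGapAt_sharp_free`); every member of ds-2's gauge-invariant tier-1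
`ℤ⁴` ball `MemBallZdG (3/125) (3/250) R` at every `0 ≤ β_W ≤ 1/3` (`su2_boundaryLimit_onBall_upTo_oneThird`) and of the
sprint ball `MemBallZdG 0.296 0.148 R` at `β_W = 1/8` (`su2_boundaryLimit_onBall_oneEighth`); every `N ≥ 2` at 't Hooft
`1/64` on `(1/10, 1/10)` (`suN_boundaryLimit_onBall_1_64`, p2's Bakry–Émery row); `SU(3)` HYPOTHESIS-FREE at
`β_W = 1/4` on `(19/500, 19/1000)` (`su3_boundaryLimit_onBall_oneQuarter`); the TIER-2 `SU(2)` ball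
`MemBallZdS 0.194 0.097 (log 2)` at `β_W = 1/16` (`su2_boundaryLimit_onBallS_1_16`, rb-p1's `su2_rowS2_1_16`). WHAT THIS
IS NOT: no rate of convergence; lattice strong-coupling statements; nothing about the continuum limit or the Clay
Millennium problem.

References: H.-O. Georgii (2011), Thm. 4.17, Prop. 7.11; the track's `OneStateBoundary.lean`, `MassGapOnBallZdGRows.lean`,
`MassGapOnBallZdGRowsSUN.lean`, `RowsS.lean`, `RowsSUN.lean`; `Thresholds/ImprovedThresholdStar.lean`,
`Thresholds/SharpStrongCouplingFree.lean`.
-/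

noncomputable section

open MeasureTheory Filter Topology Function
open Literature.Probability.LatticeModels
open Literature.MathematicalPhysics.QuantumLattice
open Literature.MathematicalPhysics.QuantumFieldTheory hiding ZdEdge
open Summit.Ventures.YMGap.RobustBallSUN (suN_massGapOnBallZd_bakryEmery_dim4_row)

namespace Summit.Ventures.YMGap.RobustBall

/-! ### Cells by name (hypothesis-free) -/

section Cells

variable {d N : ℕ}

/-- ★ **`SU(2)` Wilson on `ℤ⁴`, TWO-SIDED, every tree coupling `|b| ≤ 9/50` (Wilson `|β_W| ≤ 9/25`)**: the unique DLR
state is the limit of the finite-volume Wilson–Gibbs distributions with EVERY boundary condition — uniformly in the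
boundary field — on every bounded continuous observable (uniqueness: `su2_hasUniqueGibbsMeasure_of_abs_le`, the
star window + coupling-sign flip). [folklore] -/
theorem su2_wilson_boundaryLimit_of_abs_le {b : ℝ} (h : |b| ≤ 9 / 50) :
    ∃ μ : Measure (LGConfig 4 (SUN 2)), ymGibbsMeasures (d := 4) (fundamentalRep (Fin 2)) b = {μ} ∧
      ∀ Λs : ℕ → Finset (ZdEdge 4), (∀ Δ : Finset (ZdEdge 4), ∀ᶠ n in atTop, Δ ⊆ Λs n) →
        (∀ (ηs : ℕ → LGConfig 4 (SUN 2)) (F : LGConfig 4 (SUN 2) → ℝ), Continuous F → (∃ C, ∀ U, |F U| ≤ C) →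
          Tendsto (fun n => ∫ U, F U ∂(ymSpecification (fundamentalRep (Fin 2)) b (Λs n) (ηs n)))
            atTop (𝓝 (∫ U, F U ∂μ))) ∧
        ∀ (F : LGConfig 4 (SUN 2) → ℝ), Continuous F → (∃ C, ∀ U, |F U| ≤ C) → ∀ ε : ℝ, 0 < ε →
          ∀ᶠ n in atTop, ∀ η : LGConfig 4 (SUN 2),
            |∫ U, F U ∂(ymSpecification (fundamentalRep (Fin 2)) b (Λs n) η) - ∫ U, F U ∂μ| < ε := by
  obtain ⟨hsub, ⟨μ, hμ⟩⟩ := ImprovedThresholdStar.su2_hasUniqueGibbsMeasure_of_abs_le h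
  have hρ : Continuous (fundamentalRep (Fin 2)) := continuous_fundamentalRep (Fin 2)
  refine ⟨μ, Set.eq_singleton_iff_unique_mem.2 ⟨hμ, fun ν hν => hsub hν hμ⟩, fun Λs hcof => ⟨?_, ?_⟩⟩
  · exact fun ηs F hFc hFb =>
      tendsto_integral_ymSpecification_of_subsingleton _ hρ _ hsub hμ hcof ηs hFc hFb
  · exact fun F hFc hFb ε hε =>
      eventually_forall_abs_sub_integral_ymSpecification_lt _ hρ _ hsub hμ hcof hFc hFb hε

/-- ★ **Every `N ≥ 2`, every `d ≥ 2`, Wilson at the SHARP window, hypothesis-free**: at every 't Hooft coupling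
`|β| < 1/(8d)` (`HessianSharp.sharpThresholdSU d`; `d = 4`: `1/32`) the unique DLR state of `SU(N)` lattice Yang–Mills on `ℤ^d` is the
limit of the finite-volume Wilson–Gibbs distributions with EVERY boundary condition (p1's `massGapAt_sharp_free`).
[folklore] -/
theorem suN_wilson_boundaryLimit_sharp (hd : 2 ≤ d) (hN : 2 ≤ N) {β : ℝ} (hβ : |β| < HessianSharp.sharpThresholdSU d) :
    ∃ μ : Measure (LGConfig d (SUN N)),
      ymGibbsMeasures (d := d) (fundamentalRep (Fin N)) ((N : ℝ) * β) = {μ} ∧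
      ∀ Λs : ℕ → Finset (ZdEdge d), (∀ Δ : Finset (ZdEdge d), ∀ᶠ n in atTop, Δ ⊆ Λs n) →
        (∀ (ηs : ℕ → LGConfig d (SUN N)) (F : LGConfig d (SUN N) → ℝ), Continuous F → (∃ C, ∀ U, |F U| ≤ C) →
          Tendsto (fun n => ∫ U, F U ∂(ymSpecification (fundamentalRep (Fin N)) ((N : ℝ) * β) (Λs n) (ηs n)))
            atTop (𝓝 (∫ U, F U ∂μ))) ∧
        ∀ (F : LGConfig d (SUN N) → ℝ), Continuous F → (∃ C, ∀ U, |F U| ≤ C) → ∀ ε : ℝ, 0 < ε →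
          ∀ᶠ n in atTop, ∀ η : LGConfig d (SUN N),
            |∫ U, F U ∂(ymSpecification (fundamentalRep (Fin N)) ((N : ℝ) * β) (Λs n) η) - ∫ U, F U ∂μ| < ε :=
  boundaryLimit_of_massGapAt (SharpUniquenessJoin.massGapAt_sharp_free hd hN hβ)

/-- ★ **`SU(2)`, `ℤ⁴`, the gauge-invariant tier-1 ball UP TO `β_W = 1/3`, hypothesis-free**: for every
`0 ≤ β_W ≤ 1/3` and every member `(W, supp) ∈ MemBallZdG (3/125) (3/250) R` added to `SU(2)` Wilson at `β_W`, the one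
state is the limit of the member's finite-volume Gibbs distributions with EVERY boundary condition (ds-2's
`su2_massGapOnBallZdG_star_upTo_oneThird`). [folklore] -/
theorem su2_boundaryLimit_onBall_upTo_oneThird {βW : ℝ} (h0 : 0 ≤ βW) (h : βW ≤ 1 / 3) (R : ℕ)
    {W : Potential (ZdEdge 4) (SUN 2)} {supp : Finset (ZdEdge 4) → Finset (Finset (ZdEdge 4))}
    (hmem : MemBallZdG (3 / 125) (3 / 250) R W supp) :
    ∃ μ : Measure (LGConfig 4 (SUN 2)),
      perturbedGibbsMeasures (d := 4) (fundamentalRep (Fin 2)) (((2 : ℕ) : ℝ) * (βW / 4)) W supp = {μ} ∧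
      ∀ Λs : ℕ → Finset (ZdEdge 4), (∀ Δ : Finset (ZdEdge 4), ∀ᶠ n in atTop, Δ ⊆ Λs n) →
        (∀ (ηs : ℕ → LGConfig 4 (SUN 2)) (F : LGConfig 4 (SUN 2) → ℝ), Continuous F → (∃ C, ∀ U, |F U| ≤ C) →
          Tendsto (fun n => ∫ U, F U ∂(perturbedYM (fundamentalRep (Fin 2)) (((2 : ℕ) : ℝ) * (βW / 4)) W supp
            (Λs n) (ηs n))) atTop (𝓝 (∫ U, F U ∂μ))) ∧
        ∀ (F : LGConfig 4 (SUN 2) → ℝ), Continuous F → (∃ C, ∀ U, |F U| ≤ C) → ∀ ε : ℝ, 0 < ε →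
          ∀ᶠ n in atTop, ∀ η : LGConfig 4 (SUN 2),
            |∫ U, F U ∂(perturbedYM (fundamentalRep (Fin 2)) (((2 : ℕ) : ℝ) * (βW / 4)) W supp (Λs n) η) -
              ∫ U, F U ∂μ| < ε :=
  boundaryLimit_onBallZdG (su2_massGapOnBallZdG_star_upTo_oneThird h0 h R) hmem

/-- ★ **`SU(2)`, `ℤ⁴`, `β_W = 1/8`, the sprint ball `MemBallZdG 0.296 0.148 R`**: one state = the limit of every
boundary condition, for every member (ds-2's `su2_massGapOnBallZdG_star_oneEighth`). [folklore] -/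
theorem su2_boundaryLimit_onBall_oneEighth (R : ℕ) {W : Potential (ZdEdge 4) (SUN 2)}
    {supp : Finset (ZdEdge 4) → Finset (Finset (ZdEdge 4))} (hmem : MemBallZdG (37 / 125) (37 / 250) R W supp) :
    ∃ μ : Measure (LGConfig 4 (SUN 2)),
      perturbedGibbsMeasures (d := 4) (fundamentalRep (Fin 2)) (((2 : ℕ) : ℝ) * (1 / 32)) W supp = {μ} ∧
      ∀ Λs : ℕ → Finset (ZdEdge 4), (∀ Δ : Finset (ZdEdge 4), ∀ᶠ n in atTop, Δ ⊆ Λs n) →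
        (∀ (ηs : ℕ → LGConfig 4 (SUN 2)) (F : LGConfig 4 (SUN 2) → ℝ), Continuous F → (∃ C, ∀ U, |F U| ≤ C) →
          Tendsto (fun n => ∫ U, F U ∂(perturbedYM (fundamentalRep (Fin 2)) (((2 : ℕ) : ℝ) * (1 / 32)) W supp
            (Λs n) (ηs n))) atTop (𝓝 (∫ U, F U ∂μ))) ∧
        ∀ (F : LGConfig 4 (SUN 2) → ℝ), Continuous F → (∃ C, ∀ U, |F U| ≤ C) → ∀ ε : ℝ, 0 < ε →
          ∀ᶠ n in atTop, ∀ η : LGConfig 4 (SUN 2),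
            |∫ U, F U ∂(perturbedYM (fundamentalRep (Fin 2)) (((2 : ℕ) : ℝ) * (1 / 32)) W supp (Λs n) η) -
              ∫ U, F U ∂μ| < ε :=
  boundaryLimit_onBallZdG (su2_massGapOnBallZdG_star_oneEighth R) hmem

/-- ★ **Every `N ≥ 2`, `ℤ⁴`, 't Hooft `1/64`, `N`-uniform radii `(1/10, 1/10)`, hypothesis-free**: for every member of
`MemBallZdG (1/10) (1/10) R` the one state is the limit of every boundary condition (p2's Bakry–Émery row
`suN_massGapOnBallZd_bakryEmery_dim4_row`). [folklore] -/
theorem suN_boundaryLimit_onBall_1_64 (hN : 2 ≤ N) (R : ℕ) {W : Potential (ZdEdge 4) (SUN N)}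
    {supp : Finset (ZdEdge 4) → Finset (Finset (ZdEdge 4))} (hmem : MemBallZdG (1 / 10) (1 / 10) R W supp) :
    ∃ μ : Measure (LGConfig 4 (SUN N)),
      perturbedGibbsMeasures (d := 4) (fundamentalRep (Fin N)) ((N : ℝ) * (1 / 64)) W supp = {μ} ∧
      ∀ Λs : ℕ → Finset (ZdEdge 4), (∀ Δ : Finset (ZdEdge 4), ∀ᶠ n in atTop, Δ ⊆ Λs n) →
        (∀ (ηs : ℕ → LGConfig 4 (SUN N)) (F : LGConfig 4 (SUN N) → ℝ), Continuous F → (∃ C, ∀ U, |F U| ≤ C) →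
          Tendsto (fun n => ∫ U, F U ∂(perturbedYM (fundamentalRep (Fin N)) ((N : ℝ) * (1 / 64)) W supp
            (Λs n) (ηs n))) atTop (𝓝 (∫ U, F U ∂μ))) ∧
        ∀ (F : LGConfig 4 (SUN N) → ℝ), Continuous F → (∃ C, ∀ U, |F U| ≤ C) → ∀ ε : ℝ, 0 < ε →
          ∀ᶠ n in atTop, ∀ η : LGConfig 4 (SUN N),
            |∫ U, F U ∂(perturbedYM (fundamentalRep (Fin N)) ((N : ℝ) * (1 / 64)) W supp (Λs n) η) -
              ∫ U, F U ∂μ| < ε :=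
  boundaryLimit_onBallZdG (massGapOnBallZdG_of_massGapOnBallZd (suN_massGapOnBallZd_bakryEmery_dim4_row hN (R : ℝ)))
    hmem

/-- ★ **`SU(3)`, `ℤ⁴`, `β_W = 1/4`, HYPOTHESIS-FREE** (ds-2's `su3_massGapOnBallZdG_star_oneQuarter` on
`MemBallZdG (19/500) (19/1000) R`, 't Hooft slot `1/36 = (1/4)/9`): one state = the limit of every boundary condition.
[folklore] -/
theorem su3_boundaryLimit_onBall_oneQuarter (R : ℕ) {W : Potential (ZdEdge 4) (SUN 3)}
    {supp : Finset (ZdEdge 4) → Finset (Finset (ZdEdge 4))} (hmem : MemBallZdG (19 / 500) (19 / 1000) R W supp) :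
    ∃ μ : Measure (LGConfig 4 (SUN 3)),
      perturbedGibbsMeasures (d := 4) (fundamentalRep (Fin 3)) (((3 : ℕ) : ℝ) * (1 / 36)) W supp = {μ} ∧
      ∀ Λs : ℕ → Finset (ZdEdge 4), (∀ Δ : Finset (ZdEdge 4), ∀ᶠ n in atTop, Δ ⊆ Λs n) →
        (∀ (ηs : ℕ → LGConfig 4 (SUN 3)) (F : LGConfig 4 (SUN 3) → ℝ), Continuous F → (∃ C, ∀ U, |F U| ≤ C) →
          Tendsto (fun n => ∫ U, F U ∂(perturbedYM (fundamentalRep (Fin 3)) (((3 : ℕ) : ℝ) * (1 / 36)) W supp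
            (Λs n) (ηs n))) atTop (𝓝 (∫ U, F U ∂μ))) ∧
        ∀ (F : LGConfig 4 (SUN 3) → ℝ), Continuous F → (∃ C, ∀ U, |F U| ≤ C) → ∀ ε : ℝ, 0 < ε →
          ∀ᶠ n in atTop, ∀ η : LGConfig 4 (SUN 3),
            |∫ U, F U ∂(perturbedYM (fundamentalRep (Fin 3)) (((3 : ℕ) : ℝ) * (1 / 36)) W supp (Λs n) η) -
              ∫ U, F U ∂μ| < ε :=
  boundaryLimit_onBallZdG (su3_massGapOnBallZdG_star_oneQuarter R) hmem

/-- ★ **TIER 2, `SU(2)`, `ℤ⁴`, `β_W = 1/16`, the weighted (possibly infinite-range) ball `MemBallZdS 0.194 0.097 (log 2)`,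
hypothesis-free** (rb-p1's row `su2_rowS2_1_16`): one state = the limit of every boundary condition. [folklore] -/
theorem su2_boundaryLimit_onBallS_1_16 {W : Potential (ZdEdge 4) (SUN 2)}
    (hmem : MemBallZdS (2 * (97 / 1000)) (97 / 1000) (Real.log 2) W) :
    ∃ μ : Measure (LGConfig 4 (SUN 2)),
      perturbedGibbsMeasuresS (d := 4) (fundamentalRep (Fin 2)) (((2 : ℕ) : ℝ) * ((1 / 16 : ℝ) / 4)) W = {μ} ∧
      ∀ Λs : ℕ → Finset (ZdEdge 4), (∀ Δ : Finset (ZdEdge 4), ∀ᶠ n in atTop, Δ ⊆ Λs n) →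
        (∀ (ηs : ℕ → LGConfig 4 (SUN 2)) (F : LGConfig 4 (SUN 2) → ℝ), Continuous F → (∃ C, ∀ U, |F U| ≤ C) →
          Tendsto (fun n => ∫ U, F U ∂(perturbedYMS (fundamentalRep (Fin 2)) (((2 : ℕ) : ℝ) * ((1 / 16 : ℝ) / 4)) W
            (Λs n) (ηs n))) atTop (𝓝 (∫ U, F U ∂μ))) ∧
        ∀ (F : LGConfig 4 (SUN 2) → ℝ), Continuous F → (∃ C, ∀ U, |F U| ≤ C) → ∀ ε : ℝ, 0 < ε →
          ∀ᶠ n in atTop, ∀ η : LGConfig 4 (SUN 2),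
            |∫ U, F U ∂(perturbedYMS (fundamentalRep (Fin 2)) (((2 : ℕ) : ℝ) * ((1 / 16 : ℝ) / 4)) W (Λs n) η) -
              ∫ U, F U ∂μ| < ε :=
  boundaryLimit_onBallZdS su2_rowS2_1_16 hmem

end Cells

end Summit.Ventures.YMGap.RobustBall

end
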